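/-
Copyright: the m5 harness (cell B2b-5 `b2b-lgcu-borel`, generation 21).  Sorry-free; axioms: propext,
Classical.choice, Quot.sound.  VALUE = THEOREM (a symmetry of the level-one slice: every exclusion
transfers to inverse-transpose duals), NOT summit progress: the crux `SubgroupIdentityDesigns` is
untouched.
-/
import Mathlib
import Summits.MatrixMultiplication.MatrixMultiplication.Theorems.SubgroupIdentityDesigns.Negative.SemiregularLaw
import Summits.MatrixMultiplication.MatrixMultiplication.Theorems.SubgroupIdentityDesigns.Negative.PackingBridge

/-!
# Duality transport: level-one identity designs under the inverse-transpose automorphism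

`θ(g) = (g⁻¹)ᵀ` is an involutive automorphism of `GL_m(𝔽_p)`.  The level-one test space `F_1|_G`
is stable under `f ↦ f ∘ θ`: it is transpose-stable at every level (`tr(M gᵀ) = tr(Mᵀ g)`,
`rank Mᵀ = rank M`; `comp_trGL_mem`) and inversion-stable at level one
(`SemiregularLaw.comp_inv_mem`).  Consequently (`design_dual`) a subgroup triple `(H₁, H₂, H₃)`
carries a level-one identity design iff `(θH₁, θH₂, θH₃)` does, and the subgroup TPP transfers
too (`tpp_dual`).

USE.  Every exclusion of this directory ("no member contains `K`", "no two adjacent members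
contain `K₁, K₂`") holds verbatim for the DUALS `θ(K)` — `no_member_dual`, `no_pair_dual₁₂`,
`no_pair_dual₂₃` turn any such exclusion into its dual.  The duals are genuinely different
subgroups for the natural action on column vectors: e.g. the dual of the full centre-transvection
group `T(ℓ) = {1 + e ⊗ φ : φ(e) = 0}` (`TransvectionPair`) is the full AXIS-transvection group
`T*(e^⊥) = {1 − φ ⊗ e : φ(e) = 0}` = `{v ↦ v − v_{i₀} φ}` (all transvections with axis the
hyperplane `v_{i₀} = 0`; it has regular orbits on vectors off the axis, so no admissible-set
argument sees it directly), the translation subgroup of an affine group `AGL_{m−1}(𝔽_p)`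
embedded as a hyperplane stabiliser.  With `TransvectionPair`: for `m ≥ 3` no two adjacent members
contain full axis-transvection groups either; with `CornerGroupExclusion`, `HomologyPencil`, …:
the dual corner groups and dual pencils are excluded as well.  Every `p`, `m`, exponent.
(`run/shared/lean/b2b/levelgraded-cu/ORACLE-g21.md` §G21-14.)
-/

noncomputable section

open scoped BigOperators Classical Matrix

namespace Summit.MatrixMultiplication.MatrixMultiplication.Theorems.SubgroupIdentityDesigns.Negative
namespace DualityTransport

open Literature.Barriers.MatrixMultiplication (SubgroupTPP)
open Summit.MatrixMultiplication.MatrixMultiplication.Theorems.LieRankDesigns.Negative (GLm Mat fourierFn)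
open Summit.MatrixMultiplication.MatrixMultiplication.Theorems.LevelOneGL2Designs.Negative
open PackingBridge (exists_test)
open SemiregularLaw (comp_inv_mem)

variable {p m : ℕ}

/-! ## The automorphism `θ(g) = (g⁻¹)ᵀ` -/

/-- Transposition on `GL_m(𝔽_p)` (an anti-automorphism): `gᵀ`, with inverse `(g⁻¹)ᵀ`. -/
def trGL (g : GLm p m) : GLm p m where
  val := ((g : GLm p m) : Mat p m)ᵀ
  inv := ((g⁻¹ : GLm p m) : Mat p m)ᵀ
  val_inv := by rw [← Matrix.transpose_mul, Units.inv_mul, Matrix.transpose_one]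
  inv_val := by rw [← Matrix.transpose_mul, Units.mul_inv, Matrix.transpose_one]

/-- Underlying matrix of `trGL g`. -/
theorem coe_trGL (g : GLm p m) : ((trGL g : GLm p m) : Mat p m) = ((g : GLm p m) : Mat p m)ᵀ :=
  rfl

/-- `(gh)ᵀ = hᵀ gᵀ`. -/
theorem trGL_mul (g h : GLm p m) : trGL (g * h) = trGL h * trGL g :=
  Units.ext (by rw [coe_trGL, Units.val_mul, Units.val_mul, Matrix.transpose_mul, coe_trGL, coe_trGL])

/-- `(g⁻¹)ᵀ = (gᵀ)⁻¹`. -/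
theorem trGL_inv (g : GLm p m) : trGL g⁻¹ = (trGL g)⁻¹ :=
  Units.ext rfl

/-- `(gᵀ)ᵀ = g`. -/
theorem trGL_trGL (g : GLm p m) : trGL (trGL g) = g :=
  Units.ext (Matrix.transpose_transpose _)

/-- **The inverse-transpose automorphism** `θ(g) = (g⁻¹)ᵀ` of `GL_m(𝔽_p)`. -/
def dual : GLm p m →* GLm p m where
  toFun g := trGL g⁻¹
  map_one' := Units.ext (by rw [inv_one, coe_trGL, Units.val_one, Matrix.transpose_one])
  map_mul' g h := by
    show trGL (g * h)⁻¹ = trGL g⁻¹ * trGL h⁻¹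
    rw [mul_inv_rev, trGL_mul]

/-- `θ(g) = (g⁻¹)ᵀ` on matrices. -/
theorem coe_dual (g : GLm p m) :
    ((dual g : GLm p m) : Mat p m) = ((g⁻¹ : GLm p m) : Mat p m)ᵀ := rfl

/-- `θ` is an involution. -/
theorem dual_dual (g : GLm p m) : dual (dual g) = g := by
  show trGL (trGL g⁻¹)⁻¹ = g
  rw [← trGL_inv, inv_inv, trGL_trGL]

/-- `θ` is injective. -/
theorem dual_injective : Function.Injective (dual : GLm p m → GLm p m) :=
  Function.LeftInverse.injective dual_dual

/-- `θ ∘ θ = id`. -/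
theorem dual_comp_dual : (dual : GLm p m →* GLm p m).comp dual = MonoidHom.id _ :=
  MonoidHom.ext dual_dual

/-- `θ(θ(K)) = K` for subgroups. -/
theorem map_dual_map_dual (K : Subgroup (GLm p m)) : (K.map dual).map dual = K := by
  rw [Subgroup.map_map, dual_comp_dual, Subgroup.map_id]

/-- `θ(K) ≤ H ⟹ K ≤ θ(H)`. -/
theorem le_map_dual_of_map_dual_le {K H : Subgroup (GLm p m)} (h : K.map dual ≤ H) :
    K ≤ H.map dual := by
  have h' := Subgroup.map_mono (f := (dual : GLm p m →* GLm p m)) h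
  rwa [map_dual_map_dual] at h'

/-- The subgroup TPP transfers to the dual triple. -/
theorem tpp_dual {H₁ H₂ H₃ : Subgroup (GLm p m)} (htpp : SubgroupTPP H₁ H₂ H₃) :
    SubgroupTPP (H₁.map dual) (H₂.map dual) (H₃.map dual) := by
  rintro _ ⟨a, ha, rfl⟩ _ ⟨b, hb, rfl⟩ _ ⟨c, hc, rfl⟩ habc
  rw [← map_mul, ← map_mul, ← map_one (dual : GLm p m →* GLm p m)] at habc
  obtain ⟨rfl, rfl, rfl⟩ := htpp a ha b hb c hc (dual_injective habc)
  exact ⟨map_one _, map_one _, map_one _⟩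

variable [hp : Fact p.Prime]

/-! ## Stability of the level-one test space -/

/-- **`F_1|_G` is transpose-stable**: `f ∈ F_1 ⟹ (g ↦ f(gᵀ)) ∈ F_1` (`tr(M gᵀ) = tr(Mᵀ g)`,
`rank Mᵀ = rank M`). -/
theorem comp_trGL_mem {f : GLm p m → ℂ} (hf : f ∈ levelSubmodule p m 1) :
    (fun g : GLm p m => f (trGL g)) ∈ levelSubmodule p m 1 := by
  obtain ⟨c, hc, hfc⟩ := mem_levelSubmodule_iff.1 hf
  refine mem_levelSubmodule_iff.2 ⟨fun M => c Mᵀ, fun M hM => hc _ (by rwa [Matrix.rank_transpose]),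
    fun g => ?_⟩
  rw [hfc]
  unfold fourierFn
  rw [coe_trGL]
  let e : Mat p m ≃ Mat p m := ⟨Matrix.transpose, Matrix.transpose, fun M => Matrix.transpose_transpose M,
    fun M => Matrix.transpose_transpose M⟩
  rw [← Equiv.sum_comp e]
  refine Finset.sum_congr rfl fun M _ => ?_
  show c Mᵀ * ZMod.stdAddChar (Matrix.trace (Mᵀ * ((g : GLm p m) : Mat p m)ᵀ)) =
    c Mᵀ * ZMod.stdAddChar (Matrix.trace (M * ((g : GLm p m) : Mat p m)))
  rw [← Matrix.transpose_mul, Matrix.trace_transpose, Matrix.trace_mul_comm]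

/-- **`F_1|_G` is `θ`-stable**: `f ∈ F_1 ⟹ f ∘ θ ∈ F_1`. -/
theorem comp_dual_mem {f : GLm p m → ℂ} (hf : f ∈ levelSubmodule p m 1) :
    (fun g : GLm p m => f (dual g)) ∈ levelSubmodule p m 1 :=
  comp_inv_mem (comp_trGL_mem hf)

/-! ## Transport of the TPP and of designs -/

section Transport

variable {H₁ H₂ H₃ : Subgroup (GLm p m)}

/-- **DESIGN TRANSPORT.**  A level-one identity design for `(H₁, H₂, H₃)` (the crux's design
clause at `k = 1`) yields one for the dual triple `(θH₁, θH₂, θH₃)`: the test function `f ∘ θ`. -/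
theorem design_dual
    (hdes : ∃ c : Mat p m → ℂ, (∀ M, 1 < M.rank → c M = 0) ∧
      (∑ M, c M * ZMod.stdAddChar (Matrix.trace (M * ((1 : GLm p m) : Mat p m)))) = 1 ∧
      ∀ a ∈ H₁, ∀ b ∈ H₂, ∀ g ∈ H₃, a * b * g ≠ 1 →
        (∑ M, c M * ZMod.stdAddChar (Matrix.trace (M * ((a * b * g : GLm p m) : Mat p m)))) = 0) :
    ∃ c : Mat p m → ℂ, (∀ M, 1 < M.rank → c M = 0) ∧
      (∑ M, c M * ZMod.stdAddChar (Matrix.trace (M * ((1 : GLm p m) : Mat p m)))) = 1 ∧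
      ∀ a ∈ H₁.map dual, ∀ b ∈ H₂.map dual, ∀ g ∈ H₃.map dual, a * b * g ≠ 1 →
        (∑ M, c M * ZMod.stdAddChar (Matrix.trace (M * ((a * b * g : GLm p m) : Mat p m)))) = 0 := by
  obtain ⟨f, hf, h1, h0⟩ := exists_test (k := 1) hdes
  obtain ⟨c', hc', hfc'⟩ := mem_levelSubmodule_iff.1 (comp_dual_mem hf)
  refine ⟨c', hc', ?_, ?_⟩
  · have h := hfc' 1
    simp only [map_one] at h
    show fourierFn c' 1 = 1
    rw [← h, h1]
  · rintro _ ⟨a, ha, rfl⟩ _ ⟨b, hb, rfl⟩ _ ⟨g, hg, rfl⟩ hne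
    have key : fourierFn c' (dual a * dual b * dual g) = f (a * b * g) := by
      have h := hfc' (dual a * dual b * dual g)
      simp only [map_mul, dual_dual] at h
      exact h.symm
    show fourierFn c' (dual a * dual b * dual g) = 0
    rw [key]
    refine h0 a ha b hb g hg fun h => hne ?_
    rw [← map_mul, ← map_mul, h, map_one]

/-- **DUAL OF A SINGLE-MEMBER EXCLUSION.**  If no member of any level-one witness (TPP + design)
contains `K`, then no member contains `θ(K)` either. -/
theorem no_member_dual {K : Subgroup (GLm p m)}
    (hK : ∀ L₁ L₂ L₃ : Subgroup (GLm p m), SubgroupTPP L₁ L₂ L₃ → (K ≤ L₁ ∨ K ≤ L₂ ∨ K ≤ L₃) →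
      ¬ ∃ c : Mat p m → ℂ, (∀ M, 1 < M.rank → c M = 0) ∧
        (∑ M, c M * ZMod.stdAddChar (Matrix.trace (M * ((1 : GLm p m) : Mat p m)))) = 1 ∧
        ∀ a ∈ L₁, ∀ b ∈ L₂, ∀ g ∈ L₃, a * b * g ≠ 1 →
          (∑ M, c M * ZMod.stdAddChar (Matrix.trace (M * ((a * b * g : GLm p m) : Mat p m)))) = 0)
    (htpp : SubgroupTPP H₁ H₂ H₃) (hle : K.map dual ≤ H₁ ∨ K.map dual ≤ H₂ ∨ K.map dual ≤ H₃) :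
    ¬ ∃ c : Mat p m → ℂ, (∀ M, 1 < M.rank → c M = 0) ∧
      (∑ M, c M * ZMod.stdAddChar (Matrix.trace (M * ((1 : GLm p m) : Mat p m)))) = 1 ∧
      ∀ a ∈ H₁, ∀ b ∈ H₂, ∀ g ∈ H₃, a * b * g ≠ 1 →
        (∑ M, c M * ZMod.stdAddChar (Matrix.trace (M * ((a * b * g : GLm p m) : Mat p m)))) = 0 :=
  fun hdes => hK _ _ _ (tpp_dual htpp)
    (hle.imp le_map_dual_of_map_dual_le (Or.imp le_map_dual_of_map_dual_le le_map_dual_of_map_dual_le))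
    (design_dual hdes)

/-- **DUAL OF A PAIR EXCLUSION, members 1–2.**  If no level-one witness has `K₁ ≤ H₁` and
`K₂ ≤ H₂`, then none has `θ(K₁) ≤ H₁` and `θ(K₂) ≤ H₂`. -/
theorem no_pair_dual₁₂ {K₁ K₂ : Subgroup (GLm p m)}
    (hK : ∀ L₁ L₂ L₃ : Subgroup (GLm p m), SubgroupTPP L₁ L₂ L₃ → K₁ ≤ L₁ → K₂ ≤ L₂ →
      ¬ ∃ c : Mat p m → ℂ, (∀ M, 1 < M.rank → c M = 0) ∧
        (∑ M, c M * ZMod.stdAddChar (Matrix.trace (M * ((1 : GLm p m) : Mat p m)))) = 1 ∧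
        ∀ a ∈ L₁, ∀ b ∈ L₂, ∀ g ∈ L₃, a * b * g ≠ 1 →
          (∑ M, c M * ZMod.stdAddChar (Matrix.trace (M * ((a * b * g : GLm p m) : Mat p m)))) = 0)
    (htpp : SubgroupTPP H₁ H₂ H₃) (h₁ : K₁.map dual ≤ H₁) (h₂ : K₂.map dual ≤ H₂) :
    ¬ ∃ c : Mat p m → ℂ, (∀ M, 1 < M.rank → c M = 0) ∧
      (∑ M, c M * ZMod.stdAddChar (Matrix.trace (M * ((1 : GLm p m) : Mat p m)))) = 1 ∧
      ∀ a ∈ H₁, ∀ b ∈ H₂, ∀ g ∈ H₃, a * b * g ≠ 1 →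
        (∑ M, c M * ZMod.stdAddChar (Matrix.trace (M * ((a * b * g : GLm p m) : Mat p m)))) = 0 :=
  fun hdes => hK _ _ _ (tpp_dual htpp) (le_map_dual_of_map_dual_le h₁)
    (le_map_dual_of_map_dual_le h₂) (design_dual hdes)

/-- **DUAL OF A PAIR EXCLUSION, members 2–3.** -/
theorem no_pair_dual₂₃ {K₂ K₃ : Subgroup (GLm p m)}
    (hK : ∀ L₁ L₂ L₃ : Subgroup (GLm p m), SubgroupTPP L₁ L₂ L₃ → K₂ ≤ L₂ → K₃ ≤ L₃ →
      ¬ ∃ c : Mat p m → ℂ, (∀ M, 1 < M.rank → c M = 0) ∧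
        (∑ M, c M * ZMod.stdAddChar (Matrix.trace (M * ((1 : GLm p m) : Mat p m)))) = 1 ∧
        ∀ a ∈ L₁, ∀ b ∈ L₂, ∀ g ∈ L₃, a * b * g ≠ 1 →
          (∑ M, c M * ZMod.stdAddChar (Matrix.trace (M * ((a * b * g : GLm p m) : Mat p m)))) = 0)
    (htpp : SubgroupTPP H₁ H₂ H₃) (h₂ : K₂.map dual ≤ H₂) (h₃ : K₃.map dual ≤ H₃) :
    ¬ ∃ c : Mat p m → ℂ, (∀ M, 1 < M.rank → c M = 0) ∧
      (∑ M, c M * ZMod.stdAddChar (Matrix.trace (M * ((1 : GLm p m) : Mat p m)))) = 1 ∧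
      ∀ a ∈ H₁, ∀ b ∈ H₂, ∀ g ∈ H₃, a * b * g ≠ 1 →
        (∑ M, c M * ZMod.stdAddChar (Matrix.trace (M * ((a * b * g : GLm p m) : Mat p m)))) = 0 :=
  fun hdes => hK _ _ _ (tpp_dual htpp) (le_map_dual_of_map_dual_le h₂)
    (le_map_dual_of_map_dual_le h₃) (design_dual hdes)

end Transport

end DualityTransport
end Summit.MatrixMultiplication.MatrixMultiplication.Theorems.SubgroupIdentityDesigns.Negative
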